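import Literature.NumberTheory.EllipticCurves.QuadraticTwistProofs
import Literature.NumberTheory.EllipticCurves.MinimalModelReduction
import HarnessLib

/-!
# Quadratic (Artin–Schreier) twists of Weierstrass equations in characteristic `2`

Over a field `k` of characteristic `2` the quadratic twist of a Weierstrass equation
`E : y² + a₁xy + a₃y = x³ + a₂x² + a₄x + a₆` attached to the Artin–Schreier extension
`k(λ)`, `λ² + λ = t`, is

`E_t : y² + a₁xy + a₃y = x³ + (a₂ + t a₁²)x² + a₄x + (a₆ + t a₃²)`

(substitute `y ↦ y + λ(a₁x + a₃)` in `E`). This file proves the two facts about `E_t` over a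
*finite* field `k` of characteristic `2` that replace, at the prime `2`, the odd-characteristic
computation of Knapp, *Elliptic Curves*, Prop. 12.10 (the tree's
`card_add_one_sub_natCard_point_quadraticTwist`):

* `asTwist_eq_smul`: if `t = λ² + λ` is in the image of the Artin–Schreier map `℘(z) = z² + z` then
  `E_t = (1, 0, λa₁, λa₃) • E` is `k`-isomorphic to `E`;
* `natCard_point_add_natCard_point_asTwist`: if `t ∉ ℘(k)` and `E` is elliptic then
  `#E(k) + #E_t(k) = 2(q + 1)`, i.e. `a(E_t) = −a(E)`: over each `x` with `h = a₁x + a₃ ≠ 0` the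
  equations `y² + hy = g` and `y² + hy = g + th²` become `℘(z) = g/h²`, `℘(z) = g/h² + t` after
  `y = hz`, and exactly one of `α`, `α + t` lies in the index-`2` subgroup `℘(k)`; over `x` with
  `h = 0` both have exactly one solution (squaring is bijective);
* `b₂/b₄/b₆/b₈/c₄/Δ` of `E_t` equal those of `E` (`asTwist_Δ` etc.), so `E_t` is elliptic iff `E`
  is, and the combined statement `card_add_one_sub_natCard_point_asTwist`:
  `q + 1 − #E_t(k) = ± (q + 1 − #E(k))` with sign `+` iff `t ∈ ℘(k)`.

These are used at the place `2` for the quadratic twist of an elliptic curve over `ℚ` by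
`d ≡ 1 (mod 4)` (`QuadraticTwistLocalPolynomialTwoProofs`): the reduction modulo `2` of the
`2`-integral twisted equation is `Ē_t` with `t = (d − 1)/4 mod 2`. Everything is proved; no
definitions (the twisted equation is written out as a structure literal) and no named facts.

## References

* J. H. Silverman, *The Arithmetic of Elliptic Curves*, 2nd ed. 2009, App. A (Prop. A.1.1(b),
  Weierstrass equations and their twists in characteristic `2`), X.2, Exercise A.2.
* A. W. Knapp, *Elliptic Curves*, 1993, Prop. 12.10 (the odd-characteristic analogue).
-/

noncomputable section

open scoped Classical

namespace WeierstrassCurve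

section CharTwo

variable {k : Type*} [Field k]

/-! ### The twisted equation and its invariants -/

/-- In characteristic `2`, if `t = λ² + λ` then `E_t = (1, 0, λa₁, λa₃) • E`: the Artin–Schreier
twist by an element of `℘(k)` is a `k`-isomorphism (Silverman, *AEC* App. A, Prop. A.1.1(b) and
the change of variables `y ↦ y + λ(a₁x + a₃)`). [folklore] -/
theorem asTwist_eq_smul (h2 : (2 : k) = 0) (E : WeierstrassCurve k) {t lam : k}
    (h : lam ^ 2 + lam = t) :
    (⟨E.a₁, E.a₂ + t * E.a₁ ^ 2, E.a₃, E.a₄, E.a₆ + t * E.a₃ ^ 2⟩ : WeierstrassCurve k) =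
      (⟨1, 0, lam * E.a₁, lam * E.a₃⟩ : VariableChange k) • E := by
  ext
  · simp only [variableChange_a₁, Units.val_one, inv_one, one_mul]
    linear_combination (-(lam * E.a₁)) * h2
  · simp only [variableChange_a₂, Units.val_one, inv_one, one_pow, one_mul, mul_zero, add_zero]
    linear_combination E.a₁ ^ 2 * h + (t * E.a₁ ^ 2) * h2
  · simp only [variableChange_a₃, Units.val_one, inv_one, one_pow, one_mul, zero_mul, add_zero]
    linear_combination (-(lam * E.a₃)) * h2
  · simp only [variableChange_a₄, Units.val_one, inv_one, one_pow, one_mul, zero_mul, mul_zero,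
      add_zero]
    linear_combination (lam * E.a₁ * E.a₃ + lam ^ 2 * E.a₁ * E.a₃) * h2
  · simp only [variableChange_a₆, Units.val_one, inv_one, one_pow, one_mul, zero_mul,
      add_zero, sub_zero]
    linear_combination E.a₃ ^ 2 * h + (t * E.a₃ ^ 2) * h2

/-- `b₂(E_t) = b₂(E)` in characteristic `2`. [folklore] -/
theorem asTwist_b₂ (h2 : (2 : k) = 0) (E : WeierstrassCurve k) (t : k) :
    (⟨E.a₁, E.a₂ + t * E.a₁ ^ 2, E.a₃, E.a₄, E.a₆ + t * E.a₃ ^ 2⟩ : WeierstrassCurve k).b₂ = E.b₂ := by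
  simp only [b₂]
  linear_combination (2 * t * E.a₁ ^ 2) * h2

/-- `b₄(E_t) = b₄(E)`. [folklore] -/
theorem asTwist_b₄ (E : WeierstrassCurve k) (t : k) :
    (⟨E.a₁, E.a₂ + t * E.a₁ ^ 2, E.a₃, E.a₄, E.a₆ + t * E.a₃ ^ 2⟩ : WeierstrassCurve k).b₄ = E.b₄ := by
  simp only [b₄]

/-- `b₆(E_t) = b₆(E)` in characteristic `2`. [folklore] -/
theorem asTwist_b₆ (h2 : (2 : k) = 0) (E : WeierstrassCurve k) (t : k) :
    (⟨E.a₁, E.a₂ + t * E.a₁ ^ 2, E.a₃, E.a₄, E.a₆ + t * E.a₃ ^ 2⟩ : WeierstrassCurve k).b₆ = E.b₆ := by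
  simp only [b₆]
  linear_combination (2 * t * E.a₃ ^ 2) * h2

/-- `b₈(E_t) = b₈(E)` in characteristic `2`. [folklore] -/
theorem asTwist_b₈ (h2 : (2 : k) = 0) (E : WeierstrassCurve k) (t : k) :
    (⟨E.a₁, E.a₂ + t * E.a₁ ^ 2, E.a₃, E.a₄, E.a₆ + t * E.a₃ ^ 2⟩ : WeierstrassCurve k).b₈ = E.b₈ := by
  simp only [b₈]
  linear_combination (t * E.a₁ ^ 2 * E.a₃ ^ 2 + 2 * ((E.a₂ + t * E.a₁ ^ 2) * (E.a₆ + t * E.a₃ ^ 2) -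
    E.a₂ * E.a₆)) * h2

/-- `c₄(E_t) = c₄(E)` in characteristic `2`. [folklore] -/
theorem asTwist_c₄ (h2 : (2 : k) = 0) (E : WeierstrassCurve k) (t : k) :
    (⟨E.a₁, E.a₂ + t * E.a₁ ^ 2, E.a₃, E.a₄, E.a₆ + t * E.a₃ ^ 2⟩ : WeierstrassCurve k).c₄ = E.c₄ := by
  rw [c₄, c₄, asTwist_b₂ h2, asTwist_b₄]

/-- `Δ(E_t) = Δ(E)` in characteristic `2`; in particular `E_t` is elliptic iff `E` is. [folklore] -/
theorem asTwist_Δ (h2 : (2 : k) = 0) (E : WeierstrassCurve k) (t : k) :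
    (⟨E.a₁, E.a₂ + t * E.a₁ ^ 2, E.a₃, E.a₄, E.a₆ + t * E.a₃ ^ 2⟩ : WeierstrassCurve k).Δ = E.Δ := by
  rw [Δ, Δ, asTwist_b₂ h2, asTwist_b₄, asTwist_b₆ h2, asTwist_b₈ h2]

/-- `E_t` is elliptic when `E` is (characteristic `2`). [folklore] -/
theorem isElliptic_asTwist (h2 : (2 : k) = 0) (E : WeierstrassCurve k) [E.IsElliptic] (t : k) :
    (⟨E.a₁, E.a₂ + t * E.a₁ ^ 2, E.a₃, E.a₄, E.a₆ + t * E.a₃ ^ 2⟩ : WeierstrassCurve k).IsElliptic := by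
  rw [isElliptic_iff, asTwist_Δ h2]
  exact E.isUnit_Δ

/-! ### Counting solutions of `y² + hy = g` over a finite field of characteristic `2` -/

variable [Fintype k]

/-- In characteristic `2` squaring is injective, so `y² = a` has exactly one solution in a finite
field. [folklore] -/
theorem card_filter_sq_eq (h2 : (2 : k) = 0) (a : k) :
    (Finset.univ.filter fun y : k ↦ y ^ 2 = a).card ≤ 1 ∧
      (∃ y : k, y ^ 2 = a) := by
  have hinj : Function.Injective fun y : k ↦ y ^ 2 := by
    intro y z hyz
    have h0 : (y - z) ^ 2 = 0 := by
      dsimp only at hyz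
      linear_combination hyz + (z * (z - y)) * h2
    exact sub_eq_zero.mp (pow_eq_zero_iff two_ne_zero |>.mp h0)
  refine ⟨?_, ?_⟩
  · rw [Finset.card_le_one]
    intro y hy z hz
    rw [Finset.mem_filter] at hy hz
    exact hinj (hy.2.trans hz.2.symm)
  · obtain ⟨y, hy⟩ := (Finite.injective_iff_surjective.mp hinj) a
    exact ⟨y, hy⟩

/-- `y² = a` has exactly one solution in a finite field of characteristic `2`. [folklore] -/
theorem card_filter_sq_eq_eq_one (h2 : (2 : k) = 0) (a : k) :
    (Finset.univ.filter fun y : k ↦ y ^ 2 = a).card = 1 := by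
  obtain ⟨hle, y, hy⟩ := card_filter_sq_eq h2 a
  refine le_antisymm hle (Finset.card_pos.mpr ⟨y, ?_⟩)
  simpa using hy

/-- The fibres of the Artin–Schreier map `℘(z) = z² + z` over a finite field of characteristic `2`
have `2` elements over its image (`z` and `z + 1`) and `0` elsewhere. [folklore] -/
theorem card_filter_artinSchreier (h2 : (2 : k) = 0) (α : k) :
    (Finset.univ.filter fun z : k ↦ z ^ 2 + z = α).card =
      if ∃ z : k, z ^ 2 + z = α then 2 else 0 := by
  split_ifs with hα
  · obtain ⟨z₀, hz₀⟩ := hα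
    have h01 : (z₀ : k) ≠ z₀ + 1 := by
      intro h
      have : (1 : k) = 0 := by linear_combination -h
      exact one_ne_zero this
    have hset : (Finset.univ.filter fun z : k ↦ z ^ 2 + z = α) = {z₀, z₀ + 1} := by
      ext z
      simp only [Finset.mem_filter, Finset.mem_univ, true_and, Finset.mem_insert,
        Finset.mem_singleton]
      constructor
      · intro hz
        have hprod : (z - z₀) * (z - z₀ - 1) = 0 := by
          linear_combination hz - hz₀ + ((z₀ - z) * (z₀ + 1)) * h2
        rcases mul_eq_zero.mp hprod with h | h
        · exact Or.inl (sub_eq_zero.mp h)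
        · exact Or.inr (by linear_combination h)
      · rintro (rfl | rfl)
        · exact hz₀
        · linear_combination hz₀ + (z₀ + 1) * h2
    rw [hset, Finset.card_pair h01]
  · rw [Finset.card_eq_zero, Finset.filter_eq_empty_iff]
    exact fun z _ hz ↦ hα ⟨z, hz⟩

omit [Fintype k] in
/-- The image `℘(k)` of the Artin–Schreier map is closed under addition (it is an additive
subgroup; characteristic `2`). [folklore] -/
theorem artinSchreier_add (h2 : (2 : k) = 0) {α β : k} (hα : ∃ z : k, z ^ 2 + z = α)
    (hβ : ∃ z : k, z ^ 2 + z = β) : ∃ z : k, z ^ 2 + z = α + β := by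
  obtain ⟨u, hu⟩ := hα
  obtain ⟨w, hw⟩ := hβ
  exact ⟨u + w, by linear_combination hu + hw + (u * w) * h2⟩

/-- **The image of `℘` has index `2`**: for `t ∉ ℘(k)` and any `α`, exactly one of `α`, `α + t`
lies in `℘(k)`. Counting: `℘` is `2`-to-`1` onto its image `S`, so `2 #S = q`; `S` and `S + t` are
disjoint (else `t ∈ S`), hence partition `k`. [folklore] -/
theorem artinSchreier_xor (h2 : (2 : k) = 0) {t : k} (ht : ¬ ∃ z : k, z ^ 2 + z = t) (α : k) :
    (∃ z : k, z ^ 2 + z = α + t) ↔ ¬ ∃ z : k, z ^ 2 + z = α := by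
  constructor
  · rintro hαt hα
    obtain ⟨u, hu⟩ := hαt
    obtain ⟨w, hw⟩ := hα
    exact ht ⟨u + w, by linear_combination hu + hw + (u * w + α) * h2⟩
  · intro hα
    -- counting argument
    set S : Finset k := Finset.univ.filter fun β : k ↦ ∃ z : k, z ^ 2 + z = β with hS
    have hcardS : 2 * S.card = Fintype.card k := by
      have h := Finset.card_eq_sum_card_fiberwise (f := fun z : k ↦ z ^ 2 + z) (s := Finset.univ)
        (t := S) (fun z _ ↦ by simp [hS])
      rw [Finset.card_univ] at h
      rw [h, Finset.sum_congr rfl (fun β hβ ↦ ?_), Finset.sum_const, smul_eq_mul, mul_comm]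
      rw [card_filter_artinSchreier h2 β, if_pos]
      simpa [hS] using hβ
    by_contra hαt
    -- then `S`, `α + S` hmm: `β ↦ β + α`? we use the translate by `t`: `S` and `S + t` would both miss `α + t`… instead translate by `α`:
    -- the sets `S` and `S.image (· + α)` are disjoint (if `β ∈ S` and `β = γ + α` with `γ ∈ S`
    -- then `α = β + γ ∈ S`), each of cardinality `q / 2`, so they cover `k`; but `t ∉ S` and
    -- `t ∉ S + α` (else `t + α = t - α ∈ S`… in char 2 `t = γ + α` gives `α + t = γ + 2α`).
    have hdisj : Disjoint S (S.image fun β ↦ β + α) := by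
      rw [Finset.disjoint_left]
      rintro β hβ hβ'
      rw [Finset.mem_image] at hβ'
      obtain ⟨γ, hγ, rfl⟩ := hβ'
      simp only [hS, Finset.mem_filter, Finset.mem_univ, true_and] at hβ hγ
      obtain ⟨u, hu⟩ := hβ
      obtain ⟨w, hw⟩ := hγ
      exact hα ⟨u + w, by linear_combination hu + hw + (u * w + γ) * h2⟩
    have hinj : Function.Injective fun β : k ↦ β + α := add_left_injective α
    have hcard2 : (S ∪ S.image fun β ↦ β + α).card = Fintype.card k := by
      rw [Finset.card_union_of_disjoint hdisj, Finset.card_image_of_injective _ hinj, ← two_mul,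
        hcardS]
    have huniv : (S ∪ S.image fun β ↦ β + α) = Finset.univ :=
      Finset.eq_univ_of_card _ hcard2
    have hmem : α + t ∈ S ∪ S.image fun β ↦ β + α := by rw [huniv]; exact Finset.mem_univ _
    rw [Finset.mem_union, Finset.mem_image] at hmem
    rcases hmem with h | ⟨γ, hγ, hγ'⟩
    · exact hαt (by simpa [hS] using h)
    · simp only [hS, Finset.mem_filter, Finset.mem_univ, true_and] at hγ
      obtain ⟨w, hw⟩ := hγ
      exact ht ⟨w, by linear_combination hw + hγ'⟩

/-- For `h ≠ 0`, the number of `y` with `y² + hy = g` equals the number of `z` with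
`z² + z = g/h²` (`y = hz`). [folklore] -/
theorem card_filter_sq_add_mul_eq (g : k) {h : k} (hh : h ≠ 0) :
    (Finset.univ.filter fun y : k ↦ y ^ 2 + h * y = g).card =
      (Finset.univ.filter fun z : k ↦ z ^ 2 + z = g / h ^ 2).card := by
  refine Finset.card_bij (fun y _ ↦ y / h) (fun y hy ↦ ?_) (fun y _ z _ hyz ↦ ?_) (fun z hz ↦ ?_)
  · simp only [Finset.mem_filter, Finset.mem_univ, true_and] at hy ⊢
    field_simp
    linear_combination hy
  · field_simp at hyz
    exact hyz
  · refine ⟨h * z, ?_, by field_simp⟩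
    simp only [Finset.mem_filter, Finset.mem_univ, true_and] at hz ⊢
    field_simp at hz
    linear_combination hz

/-- **The key count**: for `t ∉ ℘(k)` and any `h, g`,
`#{y : y² + hy = g} + #{y : y² + hy = g + th²} = 2`. [folklore] -/
theorem card_add_card_asTwist_fibre (h2 : (2 : k) = 0) {t : k} (ht : ¬ ∃ z : k, z ^ 2 + z = t)
    (h g : k) :
    (Finset.univ.filter fun y : k ↦ y ^ 2 + h * y = g).card +
      (Finset.univ.filter fun y : k ↦ y ^ 2 + h * y = g + t * h ^ 2).card = 2 := by
  by_cases hh : h = 0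
  · subst hh
    simp only [zero_mul, add_zero, mul_zero, zero_pow two_ne_zero]
    rw [card_filter_sq_eq_eq_one h2]
  · rw [card_filter_sq_add_mul_eq g hh, card_filter_sq_add_mul_eq _ hh,
      card_filter_artinSchreier h2, card_filter_artinSchreier h2,
      show (g + t * h ^ 2) / h ^ 2 = g / h ^ 2 + t by field_simp]
    by_cases hα : ∃ z : k, z ^ 2 + z = g / h ^ 2
    · rw [if_pos hα, if_neg (fun h' ↦ (artinSchreier_xor h2 ht _).mp h' hα)]
    · rw [if_neg hα, if_pos ((artinSchreier_xor h2 ht _).mpr hα)]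

/-! ### Point counts of `E` and `E_t` -/

omit [Fintype k] in
/-- The affine equation of `E` at `(x, y)` in the form `y² + (a₁x + a₃)y = x³ + a₂x² + a₄x + a₆`.
[folklore] -/
theorem equation_iff_sq_add (E : WeierstrassCurve k) (x y : k) :
    E.toAffine.Equation x y ↔
      y ^ 2 + (E.a₁ * x + E.a₃) * y = x ^ 3 + E.a₂ * x ^ 2 + E.a₄ * x + E.a₆ := by
  rw [WeierstrassCurve.Affine.equation_iff]
  constructor <;> intro h <;> linear_combination h

/-- For an elliptic curve over a finite field, `#E(k) = 1 + ∑ₓ #{y : (x, y) ∈ E}`. [folklore] -/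
theorem natCard_point_eq_one_add_sum (E : WeierstrassCurve k) [E.IsElliptic] :
    Nat.card E.toAffine.Point =
      1 + ∑ x : k, (Finset.univ.filter fun y : k ↦
        y ^ 2 + (E.a₁ * x + E.a₃) * y = x ^ 3 + E.a₂ * x ^ 2 + E.a₄ * x + E.a₆).card := by
  have e : E.toAffine.Point ≃ Option {xy : k × k // E.toAffine.Equation xy.1 xy.2} :=
    WeierstrassCurve.Affine.pointEquiv E.toAffine
  rw [Nat.card_congr e, Nat.card_eq_fintype_card, Fintype.card_option, add_comm]
  congr 1
  have e1 : {xy : k × k // E.toAffine.Equation xy.1 xy.2} ≃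
      {xy : k × k // xy.2 ^ 2 + (E.a₁ * xy.1 + E.a₃) * xy.2 =
        xy.1 ^ 3 + E.a₂ * xy.1 ^ 2 + E.a₄ * xy.1 + E.a₆} :=
    Equiv.subtypeEquivRight fun xy ↦ equation_iff_sq_add E xy.1 xy.2
  rw [Fintype.card_congr e1, Fintype.card_congr (Equiv.subtypeProdEquivSigmaSubtype
      fun (x y : k) ↦ y ^ 2 + (E.a₁ * x + E.a₃) * y = x ^ 3 + E.a₂ * x ^ 2 + E.a₄ * x + E.a₆),
    Fintype.card_sigma]
  refine Finset.sum_congr rfl fun x _ ↦ ?_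
  rw [Fintype.card_subtype]

/-- **`#E(k) + #E_t(k) = 2(q + 1)` for `t ∉ ℘(k)`** (finite field of characteristic `2`, `E`
elliptic): the Artin–Schreier quadratic twist has opposite trace, `a(E_t) = −a(E)`
(Silverman, *AEC* App. A with X.2; the characteristic-`2` counterpart of Knapp Prop. 12.10).
[folklore] -/
theorem natCard_point_add_natCard_point_asTwist (h2 : (2 : k) = 0) (E : WeierstrassCurve k)
    [E.IsElliptic] {t : k} (ht : ¬ ∃ z : k, z ^ 2 + z = t) :
    haveI := isElliptic_asTwist h2 E t
    Nat.card E.toAffine.Point +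
      Nat.card (⟨E.a₁, E.a₂ + t * E.a₁ ^ 2, E.a₃, E.a₄, E.a₆ + t * E.a₃ ^ 2⟩ :
        WeierstrassCurve k).toAffine.Point = 2 * (Fintype.card k + 1) := by
  haveI := isElliptic_asTwist h2 E t
  rw [natCard_point_eq_one_add_sum E, natCard_point_eq_one_add_sum
    (⟨E.a₁, E.a₂ + t * E.a₁ ^ 2, E.a₃, E.a₄, E.a₆ + t * E.a₃ ^ 2⟩ : WeierstrassCurve k)]
  dsimp only
  have hsum : ∑ x : k, ((Finset.univ.filter fun y : k ↦
      y ^ 2 + (E.a₁ * x + E.a₃) * y = x ^ 3 + E.a₂ * x ^ 2 + E.a₄ * x + E.a₆).card +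
      (Finset.univ.filter fun y : k ↦ y ^ 2 + (E.a₁ * x + E.a₃) * y =
        x ^ 3 + (E.a₂ + t * E.a₁ ^ 2) * x ^ 2 + E.a₄ * x + (E.a₆ + t * E.a₃ ^ 2)).card) =
      ∑ _x : k, 2 := by
    refine Finset.sum_congr rfl fun x _ ↦ ?_
    have hg : x ^ 3 + (E.a₂ + t * E.a₁ ^ 2) * x ^ 2 + E.a₄ * x + (E.a₆ + t * E.a₃ ^ 2) =
        (x ^ 3 + E.a₂ * x ^ 2 + E.a₄ * x + E.a₆) + t * (E.a₁ * x + E.a₃) ^ 2 := by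
      linear_combination (-(t * E.a₁ * x * E.a₃)) * h2
    rw [hg]
    exact card_add_card_asTwist_fibre h2 ht _ _
  rw [Finset.sum_add_distrib, Finset.sum_const, smul_eq_mul, Finset.card_univ] at hsum
  omega

/-- **The trace of the Artin–Schreier twist**: `q + 1 − #E_t(k) = ± (q + 1 − #E(k))`, with sign
`+` iff `t ∈ ℘(k)` (then `E_t ≅ E` over `k`, `asTwist_eq_smul`) and `−` otherwise
(`natCard_point_add_natCard_point_asTwist`). [folklore] -/
theorem card_add_one_sub_natCard_point_asTwist (h2 : (2 : k) = 0) (E : WeierstrassCurve k)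
    [E.IsElliptic] (t : k) :
    ((Fintype.card k : ℤ) + 1 -
        Nat.card (⟨E.a₁, E.a₂ + t * E.a₁ ^ 2, E.a₃, E.a₄, E.a₆ + t * E.a₃ ^ 2⟩ :
          WeierstrassCurve k).toAffine.Point) =
      (if ∃ z : k, z ^ 2 + z = t then 1 else -1) *
        ((Fintype.card k : ℤ) + 1 - Nat.card E.toAffine.Point) := by
  split_ifs with ht
  · obtain ⟨lam, hlam⟩ := ht
    rw [asTwist_eq_smul h2 E hlam, natCard_point_smul, one_mul]
  · have h := natCard_point_add_natCard_point_asTwist h2 E ht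
    zify at h
    linear_combination -h

omit [Fintype k] in
/-- Over any field, a quadratic `aT² + bT + c` with `a, b ≠ 0` splits iff the Artin–Schreier
equation `z² + z = −ac/b²` is solvable (`T = (b/a) z`); in characteristic `2` this replaces the
discriminant criterion. [folklore] -/
theorem splits_quadratic_iff_exists_artinSchreier {a b c : k} (ha : a ≠ 0) (hb : b ≠ 0) :
    (Polynomial.C a * Polynomial.X ^ 2 + Polynomial.C b * Polynomial.X + Polynomial.C c).Splits ↔
      ∃ z : k, z ^ 2 + z = -(a * c) / b ^ 2 := by
  constructor
  · intro h
    have hdeg : (Polynomial.C a * Polynomial.X ^ 2 + Polynomial.C b * Polynomial.X +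
        Polynomial.C c).degree ≠ 0 := by
      rw [Polynomial.degree_quadratic ha]; decide
    obtain ⟨x, hx⟩ := h.exists_eval_eq_zero hdeg
    simp only [Polynomial.eval_add, Polynomial.eval_mul, Polynomial.eval_C, Polynomial.eval_pow,
      Polynomial.eval_X] at hx
    refine ⟨a * x / b, ?_⟩
    field_simp
    linear_combination hx
  · rintro ⟨z, hz⟩
    refine Polynomial.Splits.of_natDegree_eq_two (Polynomial.natDegree_quadratic ha) (x := b * z / a) ?_
    simp only [Polynomial.eval_add, Polynomial.eval_mul, Polynomial.eval_C, Polynomial.eval_pow,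
      Polynomial.eval_X]
    field_simp at hz ⊢
    linear_combination hz

omit [Fintype k] in
/-- In characteristic `2`, `c₄ = a₁⁴`. [folklore] -/
theorem c₄_eq_a₁_pow_four (h2 : (2 : k) = 0) (E : WeierstrassCurve k) : E.c₄ = E.a₁ ^ 4 := by
  simp only [c₄, b₂, b₄]
  linear_combination (4 * E.a₁ ^ 2 * E.a₂ + 8 * E.a₂ ^ 2 - 24 * E.a₄ - 12 * E.a₁ * E.a₃) * h2

omit [Fintype k] in
/-- **Node tangents of the Artin–Schreier twist** (characteristic `2`): if `c₄(E) ≠ 0` then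
Mathlib's node-tangent polynomial `c₄T² + a₁c₄T − (54b₆ − 3b₂b₄ + a₂c₄)` of `E_t` splits over `k`
iff (`t ∈ ℘(k)` ↔ that of `E` splits): the two Artin–Schreier constants differ by `t`. [folklore] -/
theorem splits_nodalTangents_asTwist_iff (h2 : (2 : k) = 0) (E : WeierstrassCurve k) (hc₄ : E.c₄ ≠ 0)
    (t : k) [Finite k] (E' : WeierstrassCurve k)
    (hE' : E' = ⟨E.a₁, E.a₂ + t * E.a₁ ^ 2, E.a₃, E.a₄, E.a₆ + t * E.a₃ ^ 2⟩) :
    (Polynomial.C E'.c₄ * Polynomial.X ^ 2 + Polynomial.C (E'.a₁ * E'.c₄) * Polynomial.X -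
        Polynomial.C (54 * E'.b₆ - 3 * E'.b₂ * E'.b₄ + E'.a₂ * E'.c₄)).Splits ↔
      ((∃ z : k, z ^ 2 + z = t) ↔
        (Polynomial.C E.c₄ * Polynomial.X ^ 2 + Polynomial.C (E.a₁ * E.c₄) * Polynomial.X -
          Polynomial.C (54 * E.b₆ - 3 * E.b₂ * E.b₄ + E.a₂ * E.c₄)).Splits) := by
  haveI := Fintype.ofFinite k
  subst hE'
  have ha₁ : E.a₁ ≠ 0 := by
    intro h
    rw [c₄_eq_a₁_pow_four h2, h, zero_pow four_ne_zero] at hc₄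
    exact hc₄ rfl
  have hb : E.a₁ * E.c₄ ≠ 0 := mul_ne_zero ha₁ hc₄
  rw [asTwist_c₄ h2, asTwist_b₂ h2, asTwist_b₄, asTwist_b₆ h2, sub_eq_add_neg, ← Polynomial.C_neg,
    sub_eq_add_neg (Polynomial.C E.c₄ * Polynomial.X ^ 2 + _), ← Polynomial.C_neg,
    splits_quadratic_iff_exists_artinSchreier hc₄ hb, splits_quadratic_iff_exists_artinSchreier hc₄ hb]
  have hα : -(E.c₄ * -(54 * E.b₆ - 3 * E.b₂ * E.b₄ + (E.a₂ + t * E.a₁ ^ 2) * E.c₄)) / (E.a₁ * E.c₄) ^ 2 =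
      -(E.c₄ * -(54 * E.b₆ - 3 * E.b₂ * E.b₄ + E.a₂ * E.c₄)) / (E.a₁ * E.c₄) ^ 2 + t := by
    field_simp
    ring
  rw [hα]
  by_cases ht : ∃ z : k, z ^ 2 + z = t
  · rw [iff_true_left ht]
    constructor
    · intro h
      obtain ⟨z, hz⟩ := h
      obtain ⟨w, hw⟩ := ht
      exact ⟨z + w, by linear_combination hz + hw + (z * w + t) * h2⟩
    · intro h
      exact artinSchreier_add h2 h ht
  · rw [iff_false_left ht, artinSchreier_xor h2 ht]

end CharTwo

end WeierstrassCurve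

end
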